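import Literature.NumberTheory.Irrationality.FischlerRivoal2003.PartialFractionDictionary
import HarnessLib

/-!
# Fischler–Rivoal 2003, Théorème 1, Proposition 1 and Théorème 4 — proofs

Topic `Literature/NumberTheory/Irrationality/FischlerRivoal2003`. Source: S. Fischler, T. Rivoal, *Approximants
de Padé et séries hypergéométriques équilibrées*, J. Math. Pures Appl. **82** (2003) 1369–1394 [FischlerRivoal2003],
§2 (pp. 1375–1379) and §3 (pp. 1379–1381), read on the page (held text
`paper:doi-10-1016-s0021-7824-03-00027-8`, p0008–p0013). This file DISCHARGES the three named facts of
`BalancedPadeApproximants.lean`: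

* `theoreme1_holds : theoreme1` — "À constante multiplicative près, le problème de Padé (8) a une unique solution, et
  elle vérifie (9), (10)";
* `proposition1_holds : proposition1` — the reciprocity `zⁿ P_{j,σ,ρ}(1/z) = (−1)^{a(n+1)+ρ+σ+j} P_{j,ρ,σ}(z)`;
* `theoreme4_holds : theoreme4` — the very-well-poised problem (19): unique solution (20)–(21) and (22).

## The printed proof and how it is followed
"Les Lemmes 1 à 3 ci-dessous montrent que le seul polynôme `Q` qui donne une solution de (12) est (à constante
multiplicative près) `Q(k) = (k − ρ)_ρ (k + n + 1)_σ`. Cela démontre “l'unicité” de la solution et la relation (9).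
On en déduit facilement (10) en calculant les coefficients `p_{a,t}` grâce à (14)." (p. 1376.) With the dictionary
of `PartialFractionDictionary.lean` (`Q = PF.poly n a (arr P)`):
* Lemme 1: the conditions at `z = ∞` beyond the `n+1` that pin `P₀` say `Q(1) = ⋯ = Q(ρ) = 0`;
* Lemme 2: the conditions at `z = 0` beyond the `n+1` that pin `P̄₀` say `Q(−n−1) = ⋯ = Q(−n−σ) = 0`;
* Lemme 3: the condition at `z = 1` says `deg Q ≤ ρ + σ` (resp. `≤ 2ρ + 1` for (19));
so `Q` is a constant multiple of `Q₁ = ∏_{i=1}^{ρ}(X − i) ∏_{i=1}^{σ}(X + n + i)` (coprime linear factors), resp.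
`Q = π·Q₁` with `deg π ≤ 1` for (19), where "`P_a((−1)^a) = 0` se traduit alors par `α = 0`" for
`π = α + β(k + n/2)` (p. 1380–1381, the antisymmetry `k ↦ n − k` being the tree's `thm4Pa_eval_neg_one_pow`).
Existence: the array of `Q₁` (resp. `(X + n/2)Q₁`) given by the surjectivity of the dictionary, with `P₀`, `P̄₀`
pinned by the first `n+1` coefficients at `∞` and at `0` (`pinInf`, `pinZero`); (9)/(20) are `A(k) = Q(k)/(k)_{n+1}^a`
and (10)/(21) are `p_{a,t} = Q(−t)/∏_{t'≠t}(t'−t)^a`. Proposition 1 and (22): "En changeant `z` en `1/z`" is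
the identity `PF.poly_reflectArr` (`Q̃(X) = (−1)^{a(n+1)} Q(−X−n)`) together with
`Q₁^{σ,ρ}(−X−n) = (−1)^{ρ+σ} Q₁^{ρ,σ}(X)`.

No new definition of mathematical content (only the explicit pinned polynomials and `Q₁`); 0 named facts.
HONEST FRAMING (cells pub-zeta5 / zeta5-irr): algebra of Padé problems; nothing here is a claim about `ζ(5)`.
-/

noncomputable section

open Finset Polynomial

namespace Literature.NumberTheory.Irrationality.FischlerRivoal2003

/-! ## Pinning `P₀` and `P̄₀` by the first `n+1` coefficients -/

/-- The non-polynomial part of the expansion at `∞`: `Σ_{j=1}^{a} wⁿP_j(1/w) L_j(w)`.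
[cite: FischlerRivoal2003, §1 (8) p. 1373] -/
def seriesInf (n a : ℕ) (P : ℕ → ℂ[X]) : PowerSeries ℂ :=
  ∑ j ∈ Icc 1 a, ((reflect n (P j) : ℂ[X]) : PowerSeries ℂ) * polylogFPS j

/-- The non-polynomial part of the expansion at `0`: `Σ_{j=1}^{a} (−1)^j P_j(z) L_j(z)`.
[cite: FischlerRivoal2003, §1 (8) p. 1373] -/
def seriesZero (a : ℕ) (P : ℕ → ℂ[X]) : PowerSeries ℂ :=
  ∑ j ∈ Icc 1 a, ((-1 : ℂ) ^ j) • (((P j : ℂ[X]) : PowerSeries ℂ) * polylogFPS j)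

/-- **`P₀` is pinned**: "quand ceux-ci [`P_1, …, P_a`] sont fixés, il existe au plus un choix pour `P₀`" — the
polynomial of degree `≤ n` whose reflection cancels the coefficients `w^0, …, w^n` of `Σ_j wⁿP_j(1/w)L_j(w)`.
[cite: FischlerRivoal2003, §1 (after (8)) p. 1373] -/
def pinInf (n a : ℕ) (P : ℕ → ℂ[X]) : ℂ[X] :=
  -∑ k ∈ range (n + 1), C (PowerSeries.coeff k (seriesInf n a P)) * X ^ (n - k)

/-- **`P̄₀` is pinned**: the polynomial of degree `≤ n` cancelling the coefficients `z^0, …, z^n` of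
`Σ_j (−1)^j P_j(z) L_j(z)`. [cite: FischlerRivoal2003, §1 (after (8)) p. 1373] -/
def pinZero (n a : ℕ) (P : ℕ → ℂ[X]) : ℂ[X] :=
  -∑ k ∈ range (n + 1), C (PowerSeries.coeff k (seriesZero a P)) * X ^ k

/-- Unfolding of `expansionAtInfinity`. [cite: FischlerRivoal2003, §1 (8) p. 1373] -/
theorem expansionAtInfinity_eq (n a : ℕ) (P₀ : ℂ[X]) (P : ℕ → ℂ[X]) :
    expansionAtInfinity n a P₀ P = ((reflect n P₀ : ℂ[X]) : PowerSeries ℂ) + seriesInf n a P := rfl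

/-- Unfolding of `expansionAtZero`. [cite: FischlerRivoal2003, §1 (8) p. 1373] -/
theorem expansionAtZero_eq (a : ℕ) (Pbar₀ : ℂ[X]) (P : ℕ → ℂ[X]) :
    expansionAtZero a Pbar₀ P = ((Pbar₀ : ℂ[X]) : PowerSeries ℂ) + seriesZero a P := rfl

/-- `deg pinInf ≤ n`. [cite: FischlerRivoal2003, §1 (after (8)) p. 1373] -/
theorem natDegree_pinInf_le (n a : ℕ) (P : ℕ → ℂ[X]) : (pinInf n a P).natDegree ≤ n := by
  unfold pinInf
  rw [natDegree_neg]
  refine natDegree_sum_le_of_forall_le _ _ fun k _ => (natDegree_C_mul_X_pow_le _ _).trans (by omega)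

/-- `deg pinZero ≤ n`. [cite: FischlerRivoal2003, §1 (after (8)) p. 1373] -/
theorem natDegree_pinZero_le (n a : ℕ) (P : ℕ → ℂ[X]) : (pinZero n a P).natDegree ≤ n := by
  unfold pinZero
  rw [natDegree_neg]
  refine natDegree_sum_le_of_forall_le _ _ fun k hk => (natDegree_C_mul_X_pow_le _ _).trans ?_
  have := mem_range.mp hk; omega

/-- Coefficients of `pinInf`: `[X^m] pinInf = −[w^{n−m}] Σ_j wⁿP_j(1/w)L_j(w)` for `m ≤ n`.
[cite: FischlerRivoal2003, §1 (after (8)) p. 1373] -/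
theorem coeff_pinInf (n a : ℕ) (P : ℕ → ℂ[X]) {m : ℕ} (hm : m ≤ n) :
    (pinInf n a P).coeff m = -PowerSeries.coeff (n - m) (seriesInf n a P) := by
  unfold pinInf
  rw [coeff_neg, finsetSum_coeff, sum_eq_single (n - m)]
  · rw [coeff_C_mul_X_pow, if_pos (by omega)]
  · intro k hk hne
    rw [coeff_C_mul_X_pow, if_neg]
    have := mem_range.mp hk; omega
  · intro h; exact absurd (mem_range.mpr (by omega)) h

/-- Coefficients of `pinZero`: `[X^m] pinZero = −[z^m] Σ_j (−1)^j P_j L_j` for `m ≤ n`.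
[cite: FischlerRivoal2003, §1 (after (8)) p. 1373] -/
theorem coeff_pinZero (n a : ℕ) (P : ℕ → ℂ[X]) {m : ℕ} (hm : m ≤ n) :
    (pinZero n a P).coeff m = -PowerSeries.coeff m (seriesZero a P) := by
  unfold pinZero
  rw [coeff_neg, finsetSum_coeff, sum_eq_single m]
  · rw [coeff_C_mul_X_pow, if_pos rfl]
  · intro k _ hne
    rw [coeff_C_mul_X_pow, if_neg (Ne.symm hne)]
  · intro h; exact absurd (mem_range.mpr (by omega)) h

/-- The pinned `P₀` kills the coefficients `w^0, …, w^n` at `∞`. [cite: FischlerRivoal2003, §1 (8) p. 1373] -/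
theorem coeff_expansionAtInfinity_pinInf (n a : ℕ) (P : ℕ → ℂ[X]) {k : ℕ} (hk : k < n + 1) :
    PowerSeries.coeff k (expansionAtInfinity n a (pinInf n a P) P) = 0 := by
  rw [expansionAtInfinity_eq, map_add, Polynomial.coeff_coe, coeff_reflect, revAt_le (by omega : k ≤ n),
    coeff_pinInf n a P (by omega : n - k ≤ n), Nat.sub_sub_self (by omega : k ≤ n), neg_add_cancel]

/-- The pinned `P̄₀` kills the coefficients `z^0, …, z^n` at `0`. [cite: FischlerRivoal2003, §1 (8) p. 1373] -/
theorem coeff_expansionAtZero_pinZero (n a : ℕ) (P : ℕ → ℂ[X]) {k : ℕ} (hk : k < n + 1) :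
    PowerSeries.coeff k (expansionAtZero a (pinZero n a P) P) = 0 := by
  rw [expansionAtZero_eq, map_add, Polynomial.coeff_coe, coeff_pinZero n a P (by omega : k ≤ n), neg_add_cancel]

/-- **"il existe au plus un choix pour `P₀`"**: any `P₀` of degree `≤ n` satisfying the conditions at `∞` up to
`wⁿ` is the pinned one. [cite: FischlerRivoal2003, §1 (after (8)) p. 1373] -/
theorem eq_pinInf {n a : ℕ} {P₀ : ℂ[X]} {P : ℕ → ℂ[X]} (hP₀ : P₀.natDegree ≤ n)
    (h : ∀ k < n + 1, PowerSeries.coeff k (expansionAtInfinity n a P₀ P) = 0) : P₀ = pinInf n a P := by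
  ext m
  by_cases hm : m ≤ n
  · have hk := h (n - m) (by omega)
    rw [expansionAtInfinity_eq, map_add, Polynomial.coeff_coe, coeff_reflect, revAt_le (by omega : n - m ≤ n),
      Nat.sub_sub_self hm] at hk
    rw [coeff_pinInf n a P hm]
    linear_combination hk
  · rw [coeff_eq_zero_of_natDegree_lt (by omega), coeff_eq_zero_of_natDegree_lt
      (lt_of_le_of_lt (natDegree_pinInf_le n a P) (by omega))]

/-- **"il existe au plus un choix pour `P̄₀`"**. [cite: FischlerRivoal2003, §1 (after (8)) p. 1373] -/
theorem eq_pinZero {n a : ℕ} {Pbar₀ : ℂ[X]} {P : ℕ → ℂ[X]} (hPbar₀ : Pbar₀.natDegree ≤ n)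
    (h : ∀ k < n + 1, PowerSeries.coeff k (expansionAtZero a Pbar₀ P) = 0) : Pbar₀ = pinZero n a P := by
  ext m
  by_cases hm : m ≤ n
  · have hk := h m (by omega)
    rw [expansionAtZero_eq, map_add, Polynomial.coeff_coe] at hk
    rw [coeff_pinZero n a P hm]
    linear_combination hk
  · rw [coeff_eq_zero_of_natDegree_lt (by omega), coeff_eq_zero_of_natDegree_lt
      (lt_of_le_of_lt (natDegree_pinZero_le n a P) (by omega))]

/-- The pinned polynomials are homogeneous in `(P_1, …, P_a)`. [cite: FischlerRivoal2003, §1 (8) p. 1373] -/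
theorem pinInf_smul {n a : ℕ} {P Q : ℕ → ℂ[X]} {c : ℂ} (h : ∀ j ∈ Icc 1 a, Q j = c • P j) :
    pinInf n a Q = c • pinInf n a P := by
  have hS : seriesInf n a Q = c • seriesInf n a P := by
    unfold seriesInf
    rw [smul_sum]
    refine sum_congr rfl fun j hj => ?_
    rw [h j hj, smul_eq_C_mul, reflect_C_mul, Polynomial.coe_mul, Polynomial.coe_C, ← PowerSeries.smul_eq_C_mul,
      smul_mul_assoc]
  unfold pinInf
  rw [hS, smul_neg, smul_sum]
  congr 1
  refine sum_congr rfl fun k _ => ?_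
  rw [PowerSeries.coeff_smul, smul_eq_mul, smul_eq_C_mul, ← mul_assoc, ← C_mul]

/-- The pinned polynomials are homogeneous in `(P_1, …, P_a)`. [cite: FischlerRivoal2003, §1 (8) p. 1373] -/
theorem pinZero_smul {n a : ℕ} {P Q : ℕ → ℂ[X]} {c : ℂ} (h : ∀ j ∈ Icc 1 a, Q j = c • P j) :
    pinZero n a Q = c • pinZero n a P := by
  have hS : seriesZero a Q = c • seriesZero a P := by
    unfold seriesZero
    rw [smul_sum]
    refine sum_congr rfl fun j hj => ?_
    rw [h j hj, smul_eq_C_mul, Polynomial.coe_mul, Polynomial.coe_C, ← PowerSeries.smul_eq_C_mul, smul_mul_assoc,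
      smul_comm]
  unfold pinZero
  rw [hS, smul_neg, smul_sum]
  congr 1
  refine sum_congr rfl fun k _ => ?_
  rw [PowerSeries.coeff_smul, smul_eq_mul, smul_eq_C_mul, ← mul_assoc, ← C_mul]

/-! ## The polynomial `Q₁ = (k − ρ)_ρ (k + n + 1)_σ` and its properties -/

/-- `(x)_m = ∏_{j<m} (x + j)`. [folklore] -/
private theorem ascPochhammer_eval_eq_prod (m : ℕ) (x : ℂ) :
    (ascPochhammer ℂ m).eval x = ∏ j ∈ range m, (x + j) := by
  induction m with
  | zero => simp
  | succ m ih => rw [ascPochhammer_succ_eval, ih, prod_range_succ]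

/-- `∏_{i ∈ [1,m]} f i = ∏_{j < m} f (j+1)`. [folklore] -/
private theorem prod_Icc_one {M : Type*} [CommMonoid M] (m : ℕ) (f : ℕ → M) :
    ∏ i ∈ Icc 1 m, f i = ∏ j ∈ range m, f (j + 1) := by
  induction m with
  | zero => simp
  | succ m ih => rw [prod_Icc_succ_top (by omega), ih, prod_range_succ]

/-- The polynomial `Q₁(k) = (k − ρ)_ρ (k + n + 1)_σ = ∏_{i=1}^{ρ} (k − i) ∏_{i=1}^{σ} (k + n + i)` of Lemmes 1–2.
[cite: FischlerRivoal2003, §2 (proof of Théorème 1: "`Q(k) = (k − ρ)_ρ (k + n + 1)_σ`") p. 1376] -/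
def Q₁ (n ρ σ : ℕ) : ℂ[X] :=
  (∏ i ∈ Icc 1 ρ, (X - C (i : ℂ))) * ∏ i ∈ Icc 1 σ, (X + C (((n + i : ℕ)) : ℂ))

/-- `Q₁` is monic. [cite: FischlerRivoal2003, §2 p. 1376] -/
theorem monic_Q₁ (n ρ σ : ℕ) : (Q₁ n ρ σ).Monic := by
  unfold Q₁
  refine Monic.mul (monic_prod_of_monic _ _ fun i _ => monic_X_sub_C _) (monic_prod_of_monic _ _ fun i _ => ?_)
  rw [show (X + C (((n + i : ℕ)) : ℂ)) = X - C (-(((n + i : ℕ)) : ℂ)) by rw [map_neg]; ring]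
  exact monic_X_sub_C _

/-- `deg Q₁ = ρ + σ`. [cite: FischlerRivoal2003, §2 p. 1376] -/
theorem natDegree_Q₁ (n ρ σ : ℕ) : (Q₁ n ρ σ).natDegree = ρ + σ := by
  unfold Q₁
  have h1 : ∀ i : ℕ, (X + C (((n + i : ℕ)) : ℂ)) = X - C (-(((n + i : ℕ)) : ℂ)) := fun i => by rw [map_neg]; ring
  rw [Monic.natDegree_mul (monic_prod_of_monic _ _ fun i _ => monic_X_sub_C _)
    (monic_prod_of_monic _ _ fun i _ => by rw [h1]; exact monic_X_sub_C _),
    natDegree_prod_of_monic _ _ fun i _ => monic_X_sub_C _,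
    natDegree_prod_of_monic _ _ fun i _ => by rw [h1]; exact monic_X_sub_C _]
  simp only [natDegree_X_sub_C, natDegree_X_add_C, sum_const, smul_eq_mul, mul_one, Nat.card_Icc,
    Nat.add_sub_cancel]

/-- `Q₁(k) = (k − ρ)_ρ (k + n + 1)_σ` as ascending Pochhammer symbols, at any complex `k`.
[cite: FischlerRivoal2003, Théorème 1 (9) p. 1373 and §2 p. 1376] -/
theorem eval_Q₁ (n ρ σ : ℕ) (k : ℂ) :
    (Q₁ n ρ σ).eval k = (ascPochhammer ℂ ρ).eval (k - ρ) * (ascPochhammer ℂ σ).eval (k + n + 1) := by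
  unfold Q₁
  rw [eval_mul, eval_prod, eval_prod, ascPochhammer_eval_eq_prod, ascPochhammer_eval_eq_prod, prod_Icc_one,
    prod_Icc_one, ← prod_range_reflect (fun j : ℕ => k - ρ + j) ρ]
  congr 1
  · refine prod_congr rfl fun j hj => ?_
    have hj' : j < ρ := mem_range.mp hj
    simp only [eval_sub, eval_X, eval_C, Nat.cast_sub (show j ≤ ρ - 1 by omega), Nat.cast_sub (show 1 ≤ ρ by omega)]
    push_cast; ring
  · refine prod_congr rfl fun j _ => ?_
    simp only [eval_add, eval_X, eval_C]; push_cast; ring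

/-- `Q₁` vanishes at `k = 1, …, ρ` (Lemme 1's roots). [cite: FischlerRivoal2003, Lemme 1 p. 1376] -/
theorem eval_Q₁_nat {n ρ σ k : ℕ} (hk : k ∈ Icc 1 ρ) : (Q₁ n ρ σ).eval (k : ℂ) = 0 := by
  unfold Q₁
  rw [eval_mul, eval_prod, prod_eq_zero hk (by simp), zero_mul]

/-- `Q₁` vanishes at `k = −n−1, …, −n−σ` (Lemme 2's roots). [cite: FischlerRivoal2003, Lemme 2 p. 1377] -/
theorem eval_Q₁_neg {n ρ σ k : ℕ} (hk : k ∈ Icc 1 σ) : (Q₁ n ρ σ).eval (-(n : ℂ) - k) = 0 := by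
  unfold Q₁
  rw [eval_mul, eval_prod, eval_prod, prod_eq_zero hk, mul_zero]
  simp only [eval_add, eval_X, eval_C]; push_cast; ring

/-- **Lemmes 1–3 combined**: a polynomial vanishing at `1, …, ρ` and `−n−1, …, −n−σ` is divisible by `Q₁` (the
linear factors are pairwise coprime). [cite: FischlerRivoal2003, §2 ("Les Lemmes 1 à 3 ci-dessous montrent que le seul
polynôme `Q` qui donne une solution de (12) est … `(k − ρ)_ρ (k + n + 1)_σ`") p. 1376] -/
theorem Q₁_dvd {n ρ σ : ℕ} {Q : ℂ[X]} (h1 : ∀ k ∈ Icc 1 ρ, Q.eval (k : ℂ) = 0)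
    (h2 : ∀ k ∈ Icc 1 σ, Q.eval (-(n : ℂ) - k) = 0) : Q₁ n ρ σ ∣ Q := by
  have hlin : ∀ i : ℕ, (X + C (((n + i : ℕ)) : ℂ)) = X - C (-(((n + i : ℕ)) : ℂ)) := fun i => by rw [map_neg]; ring
  have hcop : ∀ u v : ℂ, u ≠ v → IsCoprime (X - C u) (X - C v) := fun u v huv =>
    isCoprime_X_sub_C_of_isUnit_sub (isUnit_iff_ne_zero.mpr (sub_ne_zero.mpr huv))
  unfold Q₁
  refine IsCoprime.mul_dvd ?_ ?_ ?_
  · refine IsCoprime.prod_left fun i hi => IsCoprime.prod_right fun j hj => ?_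
    rw [hlin]
    refine hcop _ _ fun h => ?_
    have hi1 : 1 ≤ i := (mem_Icc.mp hi).1
    have : ((i + (n + j) : ℕ) : ℂ) = 0 := by push_cast at h ⊢; linear_combination h
    exact absurd (by exact_mod_cast this : i + (n + j) = 0) (by omega)
  · refine Finset.prod_dvd_of_coprime ?_ fun i hi => dvd_iff_isRoot.mpr (h1 i hi)
    intro i _ j _ hij
    exact hcop _ _ fun h => hij (by exact_mod_cast h)
  · refine Finset.prod_dvd_of_coprime ?_ fun i hi => ?_
    · intro i _ j _ hij
      simp only [Function.onFun, hlin]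
      refine hcop _ _ fun h => hij ?_
      have : ((n + i : ℕ) : ℂ) = ((n + j : ℕ) : ℂ) := by linear_combination -h
      have := (Nat.cast_injective (R := ℂ)) this
      omega
    · rw [hlin, dvd_iff_isRoot, IsRoot.def, show (-(((n + i : ℕ)) : ℂ)) = -(n : ℂ) - i by push_cast; ring]
      exact h2 i hi

/-- A multiple of a monic polynomial of no larger degree is a constant multiple. [folklore] -/
private theorem eq_C_mul_of_dvd_of_natDegree_le {D Q : ℂ[X]} (hD : D.Monic) (hdvd : D ∣ Q)
    (hdeg : Q.natDegree ≤ D.natDegree) : ∃ c : ℂ, Q = C c * D := by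
  obtain ⟨W, rfl⟩ := hdvd
  by_cases hW : W = 0
  · exact ⟨0, by simp [hW]⟩
  · have hdeg' : (D * W).natDegree = D.natDegree + W.natDegree := natDegree_mul hD.ne_zero hW
    have hW0 : W.natDegree = 0 := by omega
    refine ⟨W.coeff 0, ?_⟩
    conv_lhs => rw [eq_C_of_natDegree_eq_zero hW0]
    ring

/-- `Q₁` under the reflection `k ↦ −k−n`: `Q₁^{σ,ρ}(−X−n) = (−1)^{ρ+σ} Q₁^{ρ,σ}(X)` ("l'identité triviale
`(α)_k = (−1)^k (−α−k+1)_k`"). [cite: FischlerRivoal2003, Proposition 1 (proof) p. 1374] -/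
theorem Q₁_comp_neg (n ρ σ : ℕ) :
    (Q₁ n σ ρ).comp (-X - C (n : ℂ)) = (-1 : ℂ[X]) ^ (ρ + σ) * Q₁ n ρ σ := by
  unfold Q₁
  rw [mul_comp, Polynomial.prod_comp, Polynomial.prod_comp]
  have h1 : ∏ i ∈ Icc 1 σ, (X - C (i : ℂ)).comp (-X - C (n : ℂ)) = (-1) ^ σ * ∏ i ∈ Icc 1 σ, (X + C (((n + i : ℕ)) : ℂ)) := by
    rw [show (-1 : ℂ[X]) ^ σ = ∏ i ∈ Icc 1 σ, (-1 : ℂ[X]) by simp, ← prod_mul_distrib]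
    refine prod_congr rfl fun i _ => ?_
    rw [sub_comp, X_comp, C_comp]; push_cast; rw [map_add]; ring
  have h2 : ∏ i ∈ Icc 1 ρ, (X + C (((n + i : ℕ)) : ℂ)).comp (-X - C (n : ℂ)) = (-1) ^ ρ * ∏ i ∈ Icc 1 ρ, (X - C (i : ℂ)) := by
    rw [show (-1 : ℂ[X]) ^ ρ = ∏ i ∈ Icc 1 ρ, (-1 : ℂ[X]) by simp, ← prod_mul_distrib]
    refine prod_congr rfl fun i _ => ?_
    rw [add_comp, X_comp, C_comp]; push_cast; rw [map_add]; ring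
  rw [h1, h2, pow_add]
  ring

/-! ## Solutions in terms of `Q`: the common core of Théorèmes 1 and 4 -/

/-- The family of polynomials attached to an array: `P_j = Σ_{t ≤ n} p_{j,t} X^t`. [cite: FischlerRivoal2003, §2 p. 1376] -/
def polysOf (n : ℕ) (p : ℕ → ℕ → ℂ) : ℕ → ℂ[X] := fun j => ∑ t ∈ range (n + 1), C (p (j - 1) t) * X ^ t

/-- Coefficients of `polysOf`. [cite: FischlerRivoal2003, §2 p. 1376] -/
theorem coeff_polysOf (n : ℕ) (p : ℕ → ℕ → ℂ) (j m : ℕ) :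
    (polysOf n p j).coeff m = if m ≤ n then p (j - 1) m else 0 := by
  unfold polysOf
  rw [finsetSum_coeff]
  split_ifs with hm
  · rw [sum_eq_single m]
    · simp
    · intro t _ hne; rw [coeff_C_mul_X_pow, if_neg (Ne.symm hne)]
    · intro h; exact absurd (mem_range.mpr (by omega)) h
  · exact sum_eq_zero fun t ht => by
      rw [coeff_C_mul_X_pow, if_neg]; have := mem_range.mp ht; omega

/-- `deg P_j ≤ n` for `polysOf`. [cite: FischlerRivoal2003, §2 p. 1376] -/
theorem natDegree_polysOf_le (n : ℕ) (p : ℕ → ℕ → ℂ) (j : ℕ) : (polysOf n p j).natDegree ≤ n := by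
  rw [natDegree_le_iff_coeff_eq_zero]
  intro m hm
  rw [coeff_polysOf, if_neg (by exact_mod_cast not_le.mpr hm)]

/-- The array of `polysOf p` is `p` on the box. [cite: FischlerRivoal2003, §2 p. 1376] -/
theorem poly_arr_polysOf (n a : ℕ) (p : ℕ → ℕ → ℂ) : PF.poly n a (arr (polysOf n p)) = PF.poly n a p :=
  PF.poly_congr fun o _ t ht => by rw [arr, coeff_polysOf, if_pos ht, Nat.add_sub_cancel]

/-- **The solution set in terms of `Q`** (Lemmes 1, 2, 3 applied to a solution): for a solution of the problem
with parameters `(n, a, ρ, σ)` and order `N` at `z = 1` (`N + 1 ≤ a(n+1)`), the polynomial `Q` of `(P_1, …, P_a)`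
vanishes at `1, …, ρ` and `−n−1, …, −n−σ` and has `deg Q ≤ a(n+1) − 1 − N`.
[cite: FischlerRivoal2003, Lemmes 1–3 pp. 1376–1377] -/
theorem solution_poly_props {n a ρ σ N : ℕ} (ha : 1 ≤ a) (hN : N + 1 ≤ a * (n + 1)) {P₀ Pbar₀ : ℂ[X]}
    {P : ℕ → ℂ[X]} (hsol : IsPadeSolution n a ρ σ N P₀ Pbar₀ P) :
    (∀ k ∈ Icc 1 ρ, (PF.poly n a (arr P)).eval (k : ℂ) = 0) ∧
      (∀ k ∈ Icc 1 σ, (PF.poly n a (arr P)).eval (-(n : ℂ) - k) = 0) ∧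
        (PF.poly n a (arr P)).natDegree ≤ a * (n + 1) - 1 - N := by
  refine ⟨fun k hk => ?_, fun k hk => ?_, ?_⟩
  · have hk1 : 1 ≤ k := (mem_Icc.mp hk).1
    exact (coeff_expansionAtInfinity_eq_zero_iff hsol.natDegree_P₀ hsol.natDegree_P hk1).mp
      (hsol.atInfinity (n + k) (by have := (mem_Icc.mp hk).2; omega))
  · have hk1 : 1 ≤ k := (mem_Icc.mp hk).1
    exact (coeff_expansionAtZero_eq_zero_iff hsol.natDegree_Pbar₀ hsol.natDegree_P hk1).mp
      (hsol.atZero (n + k) (by have := (mem_Icc.mp hk).2; omega))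
  · exact (atOne_iff_natDegree_le ha hsol.natDegree_P hN).mp hsol.atOne

/-- **Existence, common core**: if `Q` vanishes at `1, …, ρ` and `−n−1, …, −n−σ` and `deg Q ≤ a(n+1) − 1 − N`, then an
array `p` with `PF.poly p = Q` gives a solution `(pinInf, pinZero, polysOf p)` of the problem with order `N` at `1`.
[cite: FischlerRivoal2003, §2 (proof of Théorème 1) p. 1376 and §3 (proof of Théorème 4) p. 1380] -/
theorem isPadeSolution_of_poly {n a ρ σ N : ℕ} (ha : 1 ≤ a) (hN : N + 1 ≤ a * (n + 1)) {p : ℕ → ℕ → ℂ} {Q : ℂ[X]}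
    (hpQ : PF.poly n a p = Q) (h1 : ∀ k ∈ Icc 1 ρ, Q.eval (k : ℂ) = 0)
    (h2 : ∀ k ∈ Icc 1 σ, Q.eval (-(n : ℂ) - k) = 0) (hdeg : Q.natDegree ≤ a * (n + 1) - 1 - N) :
    IsPadeSolution n a ρ σ N (pinInf n a (polysOf n p)) (pinZero n a (polysOf n p)) (polysOf n p) := by
  have hP : ∀ j ∈ Icc 1 a, (polysOf n p j).natDegree ≤ n := fun j _ => natDegree_polysOf_le n p j
  have hQ : PF.poly n a (arr (polysOf n p)) = Q := by rw [poly_arr_polysOf, hpQ]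
  refine ⟨natDegree_pinInf_le _ _ _, natDegree_pinZero_le _ _ _, hP, fun k hk => ?_, fun k hk => ?_, ?_⟩
  · by_cases hkn : k < n + 1
    · exact coeff_expansionAtInfinity_pinInf n a _ hkn
    · obtain ⟨k', rfl⟩ := Nat.exists_eq_add_of_le (show n + 1 ≤ k by omega)
      rw [show n + 1 + k' = n + (k' + 1) by ring]
      refine (coeff_expansionAtInfinity_eq_zero_iff (natDegree_pinInf_le _ _ _) hP (by omega)).mpr ?_
      rw [hQ]; exact_mod_cast h1 (k' + 1) (by rw [mem_Icc]; omega)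
  · by_cases hkn : k < n + 1
    · exact coeff_expansionAtZero_pinZero n a _ hkn
    · obtain ⟨k', rfl⟩ := Nat.exists_eq_add_of_le (show n + 1 ≤ k by omega)
      rw [show n + 1 + k' = n + (k' + 1) by ring]
      refine (coeff_expansionAtZero_eq_zero_iff (natDegree_pinZero_le _ _ _) hP (by omega)).mpr ?_
      rw [hQ]; exact_mod_cast h2 (k' + 1) (by rw [mem_Icc]; omega)
  · exact (atOne_iff_natDegree_le ha hP hN).mpr (by rw [hQ]; exact hdeg)

/-- **(9)/(20): the series `S` of the constructed solution is `Σ_k Q(k)/(k)_{n+1}^a z^{−k}`** — coefficientwise,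
`[w^{n+k}] expansionAtInfinity = Q(k)/∏_{t≤n}(k+t)^a` for `k ≥ 1` and `0` below.
[cite: FischlerRivoal2003, Théorème 1 (9) p. 1373; §2 ("Cela démontre … la relation (9)") p. 1376] -/
theorem expansionAtInfinity_pin_eq {n a : ℕ} (p : ℕ → ℕ → ℂ) (S : PowerSeries ℂ)
    (hS0 : PowerSeries.coeff 0 S = 0)
    (hS : ∀ k : ℕ, 1 ≤ k → PowerSeries.coeff k S * PF.den n a (k : ℂ) = (PF.poly n a p).eval (k : ℂ)) :
    expansionAtInfinity n a (pinInf n a (polysOf n p)) (polysOf n p) = PowerSeries.X ^ n * S := by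
  have hP : ∀ j ∈ Icc 1 a, (polysOf n p j).natDegree ≤ n := fun j _ => natDegree_polysOf_le n p j
  ext k
  rw [PowerSeries.coeff_X_pow_mul']
  by_cases hkn : k < n + 1
  · rw [coeff_expansionAtInfinity_pinInf n a _ hkn]
    split_ifs with h
    · rw [show k - n = 0 by omega, hS0]
    · rfl
  · obtain ⟨k', rfl⟩ := Nat.exists_eq_add_of_le (show n + 1 ≤ k by omega)
    rw [show n + 1 + k' = n + (k' + 1) by ring, if_pos (by omega), Nat.add_sub_cancel_left,
      coeff_expansionAtInfinity_add (natDegree_pinInf_le _ _ _) hP (by omega : 1 ≤ k' + 1)]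
    have hk' : ∀ t : ℕ, t ≤ n → ((k' + 1 : ℕ) : ℂ) + t ≠ 0 := fun t _ => by
      exact_mod_cast (show k' + 1 + t ≠ 0 by omega)
    have hden : PF.den n a ((k' + 1 : ℕ) : ℂ) ≠ 0 := prod_ne_zero_iff.mpr fun t ht => pow_ne_zero _ (hk' t
      (Nat.lt_succ_iff.mp (mem_range.mp ht)))
    have h1 := PF.aval_mul_den (n := n) (a := a) (arr (polysOf n p)) ((k' + 1 : ℕ) : ℂ) hk'
    rw [poly_arr_polysOf] at h1
    have h2 := hS (k' + 1) (by omega)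
    exact mul_right_cancel₀ hden (by rw [h1, h2])

/-- `(k)_{n+1}^a = ∏_{t ≤ n}(k+t)^a`: the denominators of (9)/(20) are `PF.den`. [cite: FischlerRivoal2003, (9) p. 1373] -/
theorem den_eq_ascPochhammer_pow (n a : ℕ) (k : ℂ) :
    PF.den n a k = ((ascPochhammer ℂ (n + 1)).eval k) ^ a := by
  rw [PF.den, ascPochhammer_eval_eq_prod, prod_pow]

/-- **The top coefficients of the constructed solution**: `p_{a,t} = Q(−t) · (−1)^{ta}/(t!^a (n−t)!^a)`.
[cite: FischlerRivoal2003, §2 ("On en déduit facilement (10) en calculant les coefficients `p_{a,t}` grâce à (14)")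
p. 1376] -/
theorem top_coeff_eq {n a : ℕ} (ha : 1 ≤ a) (p : ℕ → ℕ → ℂ) {t : ℕ} (ht : t ≤ n) :
    p (a - 1) t = (-1 : ℂ) ^ (t * a) * (PF.poly n a p).eval (-(t : ℂ)) /
      ((t.factorial : ℂ) ^ a * ((n - t).factorial : ℂ) ^ a) := by
  rw [PF.poly_eval_neg_natCast ha p ht, prod_pow, PF.prod_erase_sub n ht]
  have hf1 : (t.factorial : ℂ) ≠ 0 := by exact_mod_cast t.factorial_ne_zero
  have hf2 : ((n - t).factorial : ℂ) ≠ 0 := by exact_mod_cast (n - t).factorial_ne_zero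
  have hm : ((-1 : ℂ) ^ t) ^ a * (-1) ^ (t * a) = 1 := by
    rw [← pow_mul, ← pow_add, ← two_mul]; simp [pow_mul]
  field_simp
  linear_combination (p (a - 1) t * (t.factorial : ℂ) ^ a * ((n - t).factorial : ℂ) ^ a) * hm.symm

/-- **Uniqueness, common core**: if the `Q` of a solution is `c` times the `Q` of the constructed solution
`(pinInf, pinZero, polysOf p)`, the whole solution is `c` times it.
[cite: FischlerRivoal2003, §2 ("Cela démontre “l'unicité” de la solution") p. 1376] -/
theorem solution_eq_smul {n a ρ σ N : ℕ} (ha : 1 ≤ a) {p : ℕ → ℕ → ℂ} {Q₀ Qbar₀ : ℂ[X]} {Q : ℕ → ℂ[X]}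
    (hsol : IsPadeSolution n a ρ σ N Q₀ Qbar₀ Q) {c : ℂ} (hc : PF.poly n a (arr Q) = C c * PF.poly n a p) :
    Q₀ = c • pinInf n a (polysOf n p) ∧ Qbar₀ = c • pinZero n a (polysOf n p) ∧
      ∀ j ∈ Icc 1 a, Q j = c • polysOf n p j := by
  have harr : ∀ o < a, ∀ t ≤ n, arr Q o t = c * p o t := by
    have h := PF.arr_eq_of_poly_eq (n := n) ha (p := arr Q) (q := c • p) (by rw [hc, PF.poly_smul, smul_eq_C_mul])
    intro o ho t ht
    rw [h o ho t ht, Pi.smul_apply, Pi.smul_apply, smul_eq_mul]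
  have hQj : ∀ j ∈ Icc 1 a, Q j = c • polysOf n p j := by
    intro j hj
    have hj1 : 1 ≤ j := (mem_Icc.mp hj).1
    ext m
    rw [coeff_smul, coeff_polysOf, smul_eq_mul]
    by_cases hm : m ≤ n
    · rw [if_pos hm, ← harr (j - 1) (by have := (mem_Icc.mp hj).2; omega) m hm, arr, Nat.sub_add_cancel hj1]
    · rw [if_neg hm, mul_zero]
      exact coeff_eq_zero_of_natDegree_lt (lt_of_le_of_lt (hsol.natDegree_P j hj) (not_le.mp hm))
  refine ⟨?_, ?_, hQj⟩
  · rw [eq_pinInf hsol.natDegree_P₀ fun k hk => hsol.atInfinity k (by omega)]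
    exact pinInf_smul hQj
  · rw [eq_pinZero hsol.natDegree_Pbar₀ fun k hk => hsol.atZero k (by omega)]
    exact pinZero_smul hQj

/-! ## Théorème 1 -/

/-- The coefficients (10) are the top coefficients of the solution built on `Q₁`.
[cite: FischlerRivoal2003, Théorème 1 (10) p. 1373] -/
theorem polysOf_top_eq_thm1Pa {n a ρ σ : ℕ} (ha : 1 ≤ a) {p : ℕ → ℕ → ℂ} (hp : PF.poly n a p = Q₁ n ρ σ) :
    polysOf n p a = thm1Pa n a ρ σ := by
  unfold polysOf thm1Pa
  refine sum_congr rfl fun t ht => ?_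
  have ht' : t ≤ n := Nat.lt_succ_iff.mp (mem_range.mp ht)
  congr 2
  rw [top_coeff_eq ha p ht', hp, eval_Q₁, show (-(t : ℂ) + n + 1) = (n : ℂ) - t + 1 by ring]

/-- The solution built on `Q₁` has `wⁿS(1/w) = wⁿ · (9)`. [cite: FischlerRivoal2003, Théorème 1 (9) p. 1373] -/
theorem expansionAtInfinity_thm1 {n a ρ σ : ℕ} {p : ℕ → ℕ → ℂ} (hp : PF.poly n a p = Q₁ n ρ σ) :
    expansionAtInfinity n a (pinInf n a (polysOf n p)) (polysOf n p) = PowerSeries.X ^ n * thm1Series n a ρ σ := by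
  refine expansionAtInfinity_pin_eq p _ (by simp [thm1Series]) fun k hk => ?_
  rw [thm1Series, PowerSeries.coeff_mk, if_neg (by omega), hp, eval_Q₁, den_eq_ascPochhammer_pow]
  have hden : ((ascPochhammer ℂ (n + 1)).eval (k : ℂ)) ^ a ≠ 0 := by
    rw [← den_eq_ascPochhammer_pow]
    exact prod_ne_zero_iff.mpr fun t _ => pow_ne_zero _ (by exact_mod_cast (show k + t ≠ 0 by omega))
  rw [div_mul_cancel₀ _ hden]

/-- `P_a` of (10) is not the zero polynomial (its coefficient of `zⁿ` is `±(n+1)_ρ σ!/n!^a ≠ 0`), so the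
normalisation (10) fixes the multiplicative constant. [cite: FischlerRivoal2003, Théorème 1 (10) p. 1373] -/
theorem thm1Pa_ne_zero (n a ρ σ : ℕ) : thm1Pa n a ρ σ ≠ 0 := by
  intro h
  have hc := congrArg (fun q : ℂ[X] => q.coeff n) h
  simp only [thm1Pa, finsetSum_coeff, coeff_C_mul_X_pow, coeff_zero] at hc
  rw [sum_eq_single n (fun t _ hne => if_neg (Ne.symm hne)) (fun h' => absurd (mem_range.mpr (by omega)) h'),
    if_pos rfl, ascPochhammer_eval_neg_sub, Nat.sub_self, Nat.factorial_zero, Nat.cast_one, one_pow, mul_one,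
    show ((n : ℂ) - n + 1) = 1 by ring] at hc
  have h1 : (ascPochhammer ℂ ρ).eval ((n : ℂ) + 1) ≠ 0 := by
    rw [show ((n : ℂ) + 1) = ((n + 1 : ℕ) : ℂ) by push_cast; ring, ← ascPochhammer_eval_cast]
    exact_mod_cast (ascPochhammer_pos ρ (n + 1) (by omega)).ne'
  have h2 : (ascPochhammer ℂ σ).eval (1 : ℂ) ≠ 0 := by
    rw [show (1 : ℂ) = ((1 : ℕ) : ℂ) by push_cast; ring, ← ascPochhammer_eval_cast]
    exact_mod_cast (ascPochhammer_pos σ 1 (by omega)).ne'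
  have h3 : (n.factorial : ℂ) ^ a ≠ 0 := pow_ne_zero _ (by exact_mod_cast n.factorial_ne_zero)
  have h4 : (-1 : ℂ) ^ (n * a) ≠ 0 := pow_ne_zero _ (by norm_num)
  have h5 : (-1 : ℂ) ^ ρ ≠ 0 := pow_ne_zero _ (by norm_num)
  rw [div_eq_zero_iff] at hc
  rcases hc with hc | hc
  · exact (mul_ne_zero h4 (mul_ne_zero (mul_ne_zero h5 h1) h2)) hc
  · exact h3 hc

/-- **Théorème 1 PROVED.** [cite: FischlerRivoal2003, Théorème 1 p. 1373; proof §2 pp. 1375–1379] -/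
theorem theoreme1_holds : theoreme1 := by
  intro n a ρ σ ha hρσ
  have hdegQ₁ : (Q₁ n ρ σ).natDegree < a * (n + 1) := by rw [natDegree_Q₁]; omega
  obtain ⟨p, hp⟩ := PF.exists_array_of_natDegree_lt (n := n) ha (Q₁ n ρ σ) hdegQ₁
  have hN : a * (n + 1) - ρ - σ - 1 + 1 ≤ a * (n + 1) := by omega
  refine ⟨pinInf n a (polysOf n p), pinZero n a (polysOf n p), polysOf n p, ?_, polysOf_top_eq_thm1Pa ha hp,
    expansionAtInfinity_thm1 hp, ?_⟩
  · exact isPadeSolution_of_poly ha hN hp (fun k hk => eval_Q₁_nat hk) (fun k hk => eval_Q₁_neg hk)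
      (by rw [natDegree_Q₁]; omega)
  · intro Q₀ Qbar₀ Q hsol
    obtain ⟨h1, h2, h3⟩ := solution_poly_props ha hN hsol
    obtain ⟨c, hc⟩ := eq_C_mul_of_dvd_of_natDegree_le (monic_Q₁ n ρ σ) (Q₁_dvd h1 h2)
      (by rw [natDegree_Q₁]; omega)
    exact ⟨c, solution_eq_smul ha hsol (by rw [hc, hp])⟩

/-! ## Proposition 1 -/

/-- For a solution NORMALISED by (10), the polynomial `Q` is exactly `Q₁` (the multiplicative constant is `1`).
[cite: FischlerRivoal2003, Proposition 1 (proof: "cette solution est proportionnelle à `(P_{j,ρ,σ})` … Le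
coefficient de proportionnalité s'obtient à l'aide de (10)") p. 1374] -/
theorem poly_arr_eq_Q₁_of_normalised {n a ρ σ : ℕ} (ha : 1 ≤ a) (hρσ : ρ + σ + 1 ≤ a * (n + 1))
    {P₀ Pbar₀ : ℂ[X]} {P : ℕ → ℂ[X]} (hsol : IsPadeSolution n a ρ σ (a * (n + 1) - ρ - σ - 1) P₀ Pbar₀ P)
    (hPa : P a = thm1Pa n a ρ σ) : PF.poly n a (arr P) = Q₁ n ρ σ := by
  have hdegQ₁ : (Q₁ n ρ σ).natDegree < a * (n + 1) := by rw [natDegree_Q₁]; omega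
  obtain ⟨p, hp⟩ := PF.exists_array_of_natDegree_lt (n := n) ha (Q₁ n ρ σ) hdegQ₁
  have hN : a * (n + 1) - ρ - σ - 1 + 1 ≤ a * (n + 1) := by omega
  obtain ⟨h1, h2, h3⟩ := solution_poly_props ha hN hsol
  obtain ⟨c, hc⟩ := eq_C_mul_of_dvd_of_natDegree_le (monic_Q₁ n ρ σ) (Q₁_dvd h1 h2) (by rw [natDegree_Q₁]; omega)
  obtain ⟨-, -, hQ⟩ := solution_eq_smul (p := p) (c := c) ha hsol (by rw [hc, hp])
  have haI : a ∈ Icc 1 a := by rw [mem_Icc]; omega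
  have hca := hQ a haI
  rw [hPa, polysOf_top_eq_thm1Pa ha hp] at hca
  have hc1 : c = 1 := by
    have h0 : (1 - c) • thm1Pa n a ρ σ = 0 := by rw [sub_smul, one_smul, ← hca, sub_self]
    by_contra hne
    exact thm1Pa_ne_zero n a ρ σ ((smul_eq_zero.mp h0).resolve_left (sub_ne_zero.mpr (Ne.symm hne)))
  rw [hc, hc1, map_one, one_mul]

/-- From an identity of arrays `p̃ = s·p` for the reflected array to the reflected polynomials:
`zⁿ Q_j(1/z) = (−1)^j s P_j(z)`. [cite: FischlerRivoal2003, Proposition 1 (proof) p. 1374] -/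
theorem reflect_eq_smul_of_reflectArr {n a : ℕ} (ha : 1 ≤ a) {P Q : ℕ → ℂ[X]} (hQ : ∀ j ∈ Icc 1 a, (Q j).natDegree ≤ n)
    (hP : ∀ j ∈ Icc 1 a, (P j).natDegree ≤ n) {s : ℂ}
    (h : PF.poly n a (PF.reflectArr n (arr Q)) = PF.poly n a (s • arr P)) :
    ∀ j ∈ Icc 1 a, reflect n (Q j) = ((-1 : ℂ) ^ j * s) • P j := by
  intro j hj
  have hj1 : 1 ≤ j := (mem_Icc.mp hj).1
  have harr := PF.arr_eq_of_poly_eq (n := n) ha h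
  ext m
  rw [coeff_reflect, coeff_smul, smul_eq_mul]
  by_cases hm : m ≤ n
  · rw [revAt_le hm]
    have e := harr (j - 1) (by have := (mem_Icc.mp hj).2; omega) m hm
    simp only [PF.reflectArr, arr, Pi.smul_apply, smul_eq_mul, Nat.sub_add_cancel hj1] at e
    have hsq : ((-1 : ℂ) ^ j) * (-1) ^ j = 1 := by rw [← mul_pow]; norm_num
    linear_combination (-1 : ℂ) ^ j * e - (Q j).coeff (n - m) * hsq
  · rw [revAt_eq_self_of_lt (not_le.mp hm), coeff_eq_zero_of_natDegree_lt (lt_of_le_of_lt (hQ j hj) (not_le.mp hm)),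
      coeff_eq_zero_of_natDegree_lt (lt_of_le_of_lt (hP j hj) (not_le.mp hm)), mul_zero]

/-- **Proposition 1 PROVED.** [cite: FischlerRivoal2003, Proposition 1 p. 1374] -/
theorem proposition1_holds : Literature.NumberTheory.Irrationality.FischlerRivoal2003.proposition1 := by
  intro n a ρ σ ha hρσ P₀ Pbar₀ P Q₀ Qbar₀ Q hsolP hPa hsolQ hQa j hj
  have hpolyP := poly_arr_eq_Q₁_of_normalised ha hρσ hsolP hPa
  have hρσ' : σ + ρ + 1 ≤ a * (n + 1) := by omega
  have hsolQ' : IsPadeSolution n a σ ρ (a * (n + 1) - σ - ρ - 1) Q₀ Qbar₀ Q := by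
    rw [show a * (n + 1) - σ - ρ - 1 = a * (n + 1) - ρ - σ - 1 by omega]; exact hsolQ
  have hpolyQ := poly_arr_eq_Q₁_of_normalised ha hρσ' hsolQ' hQa
  have href : PF.poly n a (PF.reflectArr n (arr Q)) = PF.poly n a (((-1 : ℂ) ^ (a * (n + 1) + ρ + σ)) • arr P) := by
    rw [PF.poly_reflectArr, hpolyQ, Q₁_comp_neg, PF.poly_smul, hpolyP, smul_eq_C_mul, map_pow, map_neg, map_one]
    ring
  have := reflect_eq_smul_of_reflectArr ha hsolQ.natDegree_P hsolP.natDegree_P href j hj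
  rw [this]
  congr 1
  ring

/-! ## Théorème 4 -/

/-- The polynomial `π(k) Q₁(k)` with `π(k) = k + n/2`: the `Q` of the very-well-poised solution (20).
[cite: FischlerRivoal2003, Théorème 4 (20) and proof ("si `π(k) = k + n/2`") p. 1380] -/
def Q₄ (n ρ : ℕ) : ℂ[X] := (X + C ((n : ℂ) / 2)) * Q₁ n ρ ρ

/-- `deg Q₄ = 2ρ + 1`. [cite: FischlerRivoal2003, §3 (proof of Théorème 4) p. 1380] -/
theorem natDegree_Q₄ (n ρ : ℕ) : (Q₄ n ρ).natDegree = 2 * ρ + 1 := by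
  unfold Q₄
  have hm : (X + C ((n : ℂ) / 2)).Monic := by
    rw [show (X + C ((n : ℂ) / 2)) = X - C (-((n : ℂ) / 2)) by rw [map_neg]; ring]; exact monic_X_sub_C _
  rw [Monic.natDegree_mul hm (monic_Q₁ n ρ ρ), natDegree_Q₁]
  rw [show (X + C ((n : ℂ) / 2)) = X - C (-((n : ℂ) / 2)) by rw [map_neg]; ring, natDegree_X_sub_C]
  ring

/-- `Q₄(k) = (k + n/2)(k − ρ)_ρ (k + n + 1)_ρ`. [cite: FischlerRivoal2003, Théorème 4 (20) p. 1379] -/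
theorem eval_Q₄ (n ρ : ℕ) (k : ℂ) :
    (Q₄ n ρ).eval k = (k + n / 2) * ((ascPochhammer ℂ ρ).eval (k - ρ) * (ascPochhammer ℂ ρ).eval (k + n + 1)) := by
  rw [Q₄, eval_mul, eval_Q₁, eval_add, eval_X, eval_C]

/-- `Q₄` under `k ↦ −k−n`: `Q₄(−X−n) = −Q₄(X)`. [cite: FischlerRivoal2003, Théorème 4 (22) (proof "comme dans la
preuve de la Proposition 1") p. 1381] -/
theorem Q₄_comp_neg (n ρ : ℕ) : (Q₄ n ρ).comp (-X - C (n : ℂ)) = -Q₄ n ρ := by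
  rw [Q₄, mul_comp, Q₁_comp_neg, add_comp, X_comp, C_comp, ← two_mul, pow_mul, neg_one_sq, one_pow, one_mul]
  have : (-X - C (n : ℂ) + C ((n : ℂ) / 2)) = -(X + C ((n : ℂ) / 2)) := by
    rw [show C (n : ℂ) = C ((n : ℂ) / 2) + C ((n : ℂ) / 2) by rw [← map_add]; congr 1; ring]
    ring
  rw [this]
  ring

/-- The coefficients (21) are the top coefficients of the solution built on `Q₄`.
[cite: FischlerRivoal2003, Théorème 4 (21) p. 1380] -/
theorem polysOf_top_eq_thm4Pa {n a ρ : ℕ} (ha : 1 ≤ a) {p : ℕ → ℕ → ℂ} (hp : PF.poly n a p = Q₄ n ρ) :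
    polysOf n p a = thm4Pa n a ρ := by
  unfold polysOf thm4Pa
  refine sum_congr rfl fun t ht => ?_
  have ht' : t ≤ n := Nat.lt_succ_iff.mp (mem_range.mp ht)
  congr 2
  rw [top_coeff_eq ha p ht', hp, eval_Q₄, show (-(t : ℂ) + n + 1) = (n : ℂ) - t + 1 by ring]
  ring

/-- The solution built on `Q₄` has `wⁿS(1/w) = wⁿ · (20)`. [cite: FischlerRivoal2003, Théorème 4 (20) p. 1379] -/
theorem expansionAtInfinity_thm4 {n a ρ : ℕ} {p : ℕ → ℕ → ℂ} (hp : PF.poly n a p = Q₄ n ρ) :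
    expansionAtInfinity n a (pinInf n a (polysOf n p)) (polysOf n p) = PowerSeries.X ^ n * thm4Series n a ρ := by
  refine expansionAtInfinity_pin_eq p _ (by simp [thm4Series]) fun k hk => ?_
  rw [thm4Series, PowerSeries.coeff_mk, if_neg (by omega), hp, eval_Q₄, den_eq_ascPochhammer_pow]
  have hden : ((ascPochhammer ℂ (n + 1)).eval (k : ℂ)) ^ a ≠ 0 := by
    rw [← den_eq_ascPochhammer_pow]
    exact prod_ne_zero_iff.mpr fun t _ => pow_ne_zero _ (by exact_mod_cast (show k + t ≠ 0 by omega))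
  rw [div_mul_cancel₀ _ hden]

/-- The weights `V_t = (−t−ρ)_ρ (n−t+1)_ρ/(t!^a (n−t)!^a)` of p. 1380: for `Q = π·Q₁` the evaluation
`P_a((−1)^a) = Σ_t π(−t) V_t`. [cite: FischlerRivoal2003, §3 (proof of Théorème 4, display on p. 1380)] -/
def V (n a ρ t : ℕ) : ℂ :=
  (ascPochhammer ℂ ρ).eval (-(t : ℂ) - ρ) * (ascPochhammer ℂ ρ).eval ((n : ℂ) - t + 1) /
    ((t.factorial : ℂ) ^ a * ((n - t).factorial : ℂ) ^ a)

/-- "si `π(k) = k + n/2` alors `P_a((−1)^a) = 0` (car le changement de `k` en `n − k` change `P_a((−1)^a)` en son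
opposé)": `Σ_t (n/2 − t) V_t = 0` — the tree's `thm4Pa_eval_neg_one_pow`, unfolded.
[cite: FischlerRivoal2003, §3 (proof of Théorème 4) p. 1380–1381] -/
theorem sum_half_sub_mul_V (n a ρ : ℕ) : ∑ t ∈ range (n + 1), ((n : ℂ) / 2 - t) * V n a ρ t = 0 := by
  have h := thm4Pa_eval_neg_one_pow n a ρ
  simp only [thm4Pa, eval_finsetSum, eval_mul, eval_C, eval_pow, eval_X] at h
  rw [← h]
  refine sum_congr rfl fun t _ => ?_
  rw [V, ← pow_mul, show a * t = t * a by ring]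
  have hsq : ((-1 : ℂ) ^ (t * a)) * (-1) ^ (t * a) = 1 := by rw [← mul_pow]; norm_num
  linear_combination (-(((n : ℂ) / 2 - t) * ((ascPochhammer ℂ ρ).eval (-(t : ℂ) - ρ) *
    (ascPochhammer ℂ ρ).eval ((n : ℂ) - t + 1)) /
      ((t.factorial : ℂ) ^ a * ((n - t).factorial : ℂ) ^ a))) * hsq

/-- "si `π(k) = 1` pour tout `k` alors `P_a((−1)^a) ≠ 0` (car c'est une somme de termes non nuls du même signe)":
`Σ_t V_t ≠ 0`. [cite: FischlerRivoal2003, §3 (proof of Théorème 4) p. 1380] -/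
theorem sum_V_ne_zero (n a ρ : ℕ) : ∑ t ∈ range (n + 1), V n a ρ t ≠ 0 := by
  -- `V_t = (−1)^ρ N_t/D_t` with positive integers `N_t`, `D_t`
  set N : ℕ → ℕ := fun t => (ascPochhammer ℕ ρ).eval (t + 1) * (ascPochhammer ℕ ρ).eval (n - t + 1) with hN
  set D : ℕ → ℕ := fun t => t.factorial ^ a * (n - t).factorial ^ a with hD
  have hVW : ∀ t ∈ range (n + 1), V n a ρ t = (-1) ^ ρ * (((N t : ℕ) : ℂ) / ((D t : ℕ) : ℂ)) := by
    intro t ht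
    have ht' : t ≤ n := Nat.lt_succ_iff.mp (mem_range.mp ht)
    rw [V, ascPochhammer_eval_neg_sub]
    simp only [hN, hD, Nat.cast_mul, Nat.cast_pow]
    rw [ascPochhammer_eval_cast, ascPochhammer_eval_cast, Nat.cast_succ, Nat.cast_succ, Nat.cast_sub ht']
    ring
  have hpos : 0 < ∑ t ∈ range (n + 1), ((N t : ℕ) : ℝ) / ((D t : ℕ) : ℝ) := by
    refine sum_pos (fun t _ => div_pos ?_ ?_) ⟨0, mem_range.mpr (Nat.succ_pos n)⟩
    · exact Nat.cast_pos.mpr (Nat.mul_pos (ascPochhammer_pos ρ (t + 1) (by omega))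
        (ascPochhammer_pos ρ (n - t + 1) (by omega)))
    · exact Nat.cast_pos.mpr (Nat.mul_pos (Nat.pow_pos t.factorial_pos) (Nat.pow_pos (n - t).factorial_pos))
  have hcast : (((∑ t ∈ range (n + 1), ((N t : ℕ) : ℝ) / ((D t : ℕ) : ℝ) : ℝ)) : ℂ) =
      ∑ t ∈ range (n + 1), ((N t : ℕ) : ℂ) / ((D t : ℕ) : ℂ) := by
    rw [Complex.ofReal_sum]
    exact sum_congr rfl fun t _ => by rw [Complex.ofReal_div, Complex.ofReal_natCast, Complex.ofReal_natCast]
  rw [sum_congr rfl hVW, ← mul_sum, ← hcast]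
  exact mul_ne_zero (pow_ne_zero _ (by norm_num)) (Complex.ofReal_ne_zero.mpr hpos.ne')

/-- For `Q = π·Q₁` with `deg π ≤ 1`, written `π = α + β(X + n/2)`: `P_a((−1)^a) = α Σ_t V_t`, so the condition
`P_a((−1)^a) = 0` "se traduit alors par `α = 0`". [cite: FischlerRivoal2003, §3 (proof of Théorème 4) p. 1380–1381] -/
theorem eval_top_of_poly_eq {n a ρ : ℕ} (ha : 1 ≤ a) {P : ℕ → ℂ[X]} (hPa : (P a).natDegree ≤ n) (α β : ℂ)
    (hQ : PF.poly n a (arr P) = (C α + C β * (X + C ((n : ℂ) / 2))) * Q₁ n ρ ρ) :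
    (P a).eval ((-1 : ℂ) ^ a) = α * ∑ t ∈ range (n + 1), V n a ρ t := by
  rw [eval_eq_sum_range' (lt_of_le_of_lt hPa (Nat.lt_succ_self n))]
  have hcoef : ∀ t ∈ range (n + 1), (P a).coeff t * ((-1 : ℂ) ^ a) ^ t =
      (α + β * ((n : ℂ) / 2 - t)) * V n a ρ t := by
    intro t ht
    have ht' : t ≤ n := Nat.lt_succ_iff.mp (mem_range.mp ht)
    have h1 : (P a).coeff t = arr P (a - 1) t := by rw [arr, Nat.sub_add_cancel ha]
    rw [h1, top_coeff_eq ha (arr P) ht', hQ, eval_mul, eval_Q₁, V]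
    simp only [eval_add, eval_mul, eval_C, eval_X]
    rw [← pow_mul, show a * t = t * a by ring, show (-(t : ℂ) + n + 1) = (n : ℂ) - t + 1 by ring]
    have hsq : ((-1 : ℂ) ^ (t * a)) * (-1) ^ (t * a) = 1 := by rw [← mul_pow]; norm_num
    linear_combination ((α + β * ((n : ℂ) / 2 - t)) * ((ascPochhammer ℂ ρ).eval (-(t : ℂ) - ρ) *
      (ascPochhammer ℂ ρ).eval ((n : ℂ) - t + 1)) / ((t.factorial : ℂ) ^ a * ((n - t).factorial : ℂ) ^ a)) * hsq
  rw [sum_congr rfl hcoef]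
  have hsplit : ∑ t ∈ range (n + 1), (α + β * ((n : ℂ) / 2 - t)) * V n a ρ t =
      α * ∑ t ∈ range (n + 1), V n a ρ t + β * ∑ t ∈ range (n + 1), ((n : ℂ) / 2 - t) * V n a ρ t := by
    rw [mul_sum, mul_sum, ← sum_add_distrib]
    exact sum_congr rfl fun t _ => by ring
  rw [hsplit, sum_half_sub_mul_V, mul_zero, add_zero]

/-- **Théorème 4 PROVED.** [cite: FischlerRivoal2003, Théorème 4 p. 1379–1380; proof §3 pp. 1380–1381] -/
theorem theoreme4_holds : theoreme4 := by
  intro n a ρ ha hρ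
  have hdegQ₄ : (Q₄ n ρ).natDegree < a * (n + 1) := by rw [natDegree_Q₄]; omega
  obtain ⟨p, hp⟩ := PF.exists_array_of_natDegree_lt (n := n) ha (Q₄ n ρ) hdegQ₄
  have hN : a * (n + 1) - 2 * ρ - 2 + 1 ≤ a * (n + 1) := by omega
  have hPa : polysOf n p a = thm4Pa n a ρ := polysOf_top_eq_thm4Pa ha hp
  have h1 : ∀ k ∈ Icc 1 ρ, (Q₄ n ρ).eval (k : ℂ) = 0 := fun k hk => by rw [Q₄, eval_mul, eval_Q₁_nat hk, mul_zero]
  have h2 : ∀ k ∈ Icc 1 ρ, (Q₄ n ρ).eval (-(n : ℂ) - k) = 0 := fun k hk => by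
    rw [Q₄, eval_mul, eval_Q₁_neg hk, mul_zero]
  refine ⟨pinInf n a (polysOf n p), pinZero n a (polysOf n p), polysOf n p, ⟨?_, ?_⟩, hPa,
    expansionAtInfinity_thm4 hp, ?_, ?_⟩
  · exact isPadeSolution_of_poly ha hN hp h1 h2 (by rw [natDegree_Q₄]; omega)
  · rw [hPa]; exact thm4Pa_eval_neg_one_pow n a ρ
  · -- (22): the reflected array has polynomial `(−1)^{a(n+1)} Q₄(−X−n) = (−1)^{a(n+1)+1} Q₄`
    have hP : ∀ j ∈ Icc 1 a, (polysOf n p j).natDegree ≤ n := fun j _ => natDegree_polysOf_le n p j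
    have href : PF.poly n a (PF.reflectArr n (arr (polysOf n p))) =
        PF.poly n a (((-1 : ℂ) ^ (a * (n + 1) + 1)) • arr (polysOf n p)) := by
      rw [PF.poly_reflectArr, poly_arr_polysOf, hp, Q₄_comp_neg, PF.poly_smul, poly_arr_polysOf, hp, smul_eq_C_mul,
        map_pow, map_neg, map_one, pow_succ]
      ring
    intro j hj
    rw [reflect_eq_smul_of_reflectArr ha hP hP href j hj]
    congr 1
    ring
  · intro Q₀ Qbar₀ Q hsol hQa
    obtain ⟨hr1, hr2, hr3⟩ := solution_poly_props ha hN hsol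
    -- `Q = W·Q₁` with `deg W ≤ 1`
    obtain ⟨W, hW⟩ := Q₁_dvd hr1 hr2
    have hW1 : W.natDegree ≤ 1 := by
      by_cases hW0 : W = 0
      · rw [hW0, natDegree_zero]; omega
      · have := natDegree_mul (monic_Q₁ n ρ ρ).ne_zero hW0
        rw [← hW, natDegree_Q₁] at this
        omega
    -- `W = α + β (X + n/2)`
    set β : ℂ := W.coeff 1 with hβ
    set α : ℂ := W.coeff 0 - β * ((n : ℂ) / 2) with hα
    have hWeq : W = C α + C β * (X + C ((n : ℂ) / 2)) := by
      conv_lhs => rw [eq_X_add_C_of_natDegree_le_one hW1]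
      rw [hα, map_sub, map_mul]
      ring
    have hQ : PF.poly n a (arr Q) = (C α + C β * (X + C ((n : ℂ) / 2))) * Q₁ n ρ ρ := by rw [hW, hWeq, mul_comm]
    have haI : a ∈ Icc 1 a := by rw [mem_Icc]; omega
    have heval := eval_top_of_poly_eq ha (hsol.natDegree_P a haI) α β hQ
    rw [hQa] at heval
    have hα0 : α = 0 := by
      rcases mul_eq_zero.mp heval.symm with h | h
      · exact h
      · exact absurd h (sum_V_ne_zero n a ρ)
    have hc : PF.poly n a (arr Q) = C β * PF.poly n a p := by
      rw [hQ, hα0, hp, Q₄, map_zero, zero_add, mul_assoc]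
    exact ⟨β, solution_eq_smul ha hsol hc⟩

end Literature.NumberTheory.Irrationality.FischlerRivoal2003
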